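import Summits.QuantumFields.BalabanUV.T4Continuum.Spine.NE3.SupplierB8SfClass
import Summits.QuantumFields.BalabanUV.T4Continuum.Spine.NE3.PairLandauB8EndSfClassR25
import HarnessLib

/-!
# T⁴ programme, node NE3 — THE END ON B8's SURFACE OVER `sfClass` WITH THE SUPPLIER AND THE TANGENT PROJECTION BOUND DISCHARGED:
# covariant root ⇐ `PairLandauGaugeB8Avg` ([B8] Thm 2 + (1.37) TYPE) ∧ Π-REG per pair (F6) ∧ `LandauCorrectionSupB8` per pair ([B9] (3.42)∕(3.48) TYPE, F5)
# ∧ (P♮) on `slicB8` per pair ([B9] Thm 3.3 TYPE) ∧ UNIFORM numeric lines — nothing else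

Cell `pub-balaban-gaps` (YM blitz, track G2, seat `ne3`, unit `pub-balaban-gaps-ne3`; writer prover-pub-balaban-gaps-ne3-g4-0, 2026-08-23), census
`run/shared/lean/pub/pub-balaban-gaps/ne/NE3.md` §6 NEXT (1) — «the `sfClass` END re-run with `hsupp` discharged».  Inputs BY NAME:
`PairLandauB8EndSfClassR25.ne3EnergyRateWCov_sfClass_of_pairLandauGaugeB8Avg_R25` (the `sfClass` END with R25 discharged; its per-pair binder `hsupp` asks for the
supplier `DecomposedRepT … (slicB8 …)` with UNIFORM sizes `ν κ₁ κ₂`, `pathΓ X N 0 = Z`, the four per-pair lines, and (P♮)) and `SupplierB8SfClass.decomposedRepT_sfClass_of_landauRepB8Avg`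
(gen 4: exactly that, from `LandauRepB8Avg` ∧ Π-REG ∧ the F5 shape ∧ uniform lines, with `ν̂ κ̂₁ κ̂₂` uniform).

CONTENT (0 sorry, no `def`): **`ne3EnergyRateWCov_sfClass_B8`** — for `3 ≤ d`, `2 ≤ L`, `1 ≤ N`: `NE3EnergyRateWCov d (sfClass d L N ε) L N b g ((1+θ₀)(4∕cΛ)(K₂₅·C′_{R♯5d})) s₁ s₂ dom`
(`θ₀ = ν̂ + 23√2√(16d+1)(1+ν̂)`, `K₂₅ = 1 + √(192·d·L·(d+#planes))`) FROM: `PairLandauGaugeB8Avg d (sfClass d L N ε) L N b g s₁ s₂ 1 dom` ([Balaban1985RegularSpaces] Thm 2 ∘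
[Balaban1985Variational] Thm 1 TYPE, read at the pair with (1.37)); per pair (levels `j+1`∕`j+2`, per representative `(u, Z)`): a Π-REG majorant `LocalSupMajorant L N (j+1) Z m Ĉ` with
`m ≤ s₁ξ` (regularity TYPE of the discrepancy, ours — finding F6; NOT printed; removable by the unprinted bilinear remainder bound R26), the F5 shape `LandauCorrectionSupB8 … K₀ K₁` at
`W = cavg L U_B` ([Balaban1985BackgroundPropagators] (3.42)∕(3.48) TYPE), (P♮) `SlicePoincare L (j+1) W (slicB8 …) CP …` ([Balaban1985BackgroundPropagators] Thm 3.3 TYPE); and UNIFORM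
numeric lines in `(ε, b, α₀, s₁, Ĉ, K₀, K₁, A_N, A_c, â, Λ, CP)` — the class lines `hbs hbε' h1 h2`, `ε ≤ 1`, `ε < α₀`, `cruxC·ε < 1`, `thetaLoc·ε < 1`, K6-Ξ's ε-line, the
[B7]-Prop-4 regime, the currency letters `A_N A_c â`, the size lines, the ν-line `hρ`, (J1)∕(J2) lines, `hreg₁`, `hbudget`.

HONEST FRAMING.  An implication; EVERY displayed hypothesis of Bałaban-type is OPEN for his minimisers and NOTHING of Bałaban's is proved here; the numeric lines are not
checked here for any `(d, L)` (at `d = 4`, `L = 2` they force very small `ε, s₁` — recorded, census G4); the covariant root and **NE3 are NOT proved**; spine PROVED 0∕9;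
finite T⁴ rung (B)+1 — NOT continuum YM on ℝ⁴, NOT infinite volume, NOT mass gap, NOT `BetaPertH`, NOT Clay.  ABSOLUTE RULE kept (no printed sentence is a hypothesis; the
printed theorems enter as TYPED SHAPES read at the pair).  PLACEMENT: `Summits/QuantumFields/BalabanUV/T4Continuum/Spine/NE3/`; imports accepted modules only; moves nothing.
-/

set_option autoImplicit false

open scoped BigOperators Matrix.Norms.L2Operator
open NormedSpace Finset

namespace Summit.QuantumFields.BalabanUV.T4Continuum.NE3.PairLandauB8EndSfClassB8

open Set
open Literature.MathematicalPhysics.QuantumFieldTheory.Balaban1983to89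
open B7Prop1Explicit B7Prop2Explicit B7Prop3Flat MatrixLog
open T4AveragingDeficitWall (IsSkewDir IsUnitaryCfg SmallField)
open T4AveragingDeficitWallBoundary (IsPeriodicCfg periodBox)
open AveragingDeficitPeriodicCounting (IsPeriodicDir)
open AveragingDeficitChartCalculus (cavg)
open AveragingDeficitMultiLevelPrep (LevelSmall)
open AveragingDeficitTwoLevelPrep (twoLevelSmall)
open MinimalActionSandwich (IsMinimiser)
open MinimalActionRate (Regular sfClass)
open NE3EnergyWeightedCovShape (NE3EnergyRateWCov)
open NE3SlicePoincareShape (SlicePoincare)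
open NE3EnergyRateWSupOfSlicePoincare (cLambda)
open NE3LinearNormalPartPreSizes (LocalSupMajorant)
open NE3QbarIterCovLiftPrep (cruxC liftC liftC_nonneg)
open NE3RightInverseSolveLetters (thetaLoc)
open NE3.PairLandauB8Avg (LandauRepB8Avg PairLandauGaugeB8Avg slicB8)
open NE3.LandauProjectionSupShape (LandauCorrectionSupB8)
open NE3.SupplierB8SfClass (decomposedRepT_sfClass_of_landauRepB8Avg)
open NE3.PairLandauB8EndSfClassR25 (ne3EnergyRateWCov_sfClass_of_pairLandauGaugeB8Avg_R25)

noncomputable section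

variable {d : ℕ} {n : Type*} [Fintype n] [DecidableEq n]

/-- **THE END ON B8's SURFACE OVER `sfClass`, SUPPLIER AND TANGENT PROJECTION BOUND DISCHARGED** (see the module docstring for the list of displayed inputs):
`NE3EnergyRateWCov d (sfClass d L N ε) L N b g ((1+θ₀)(4∕cΛ)(K₂₅·C′_{R♯5d})) s₁ s₂ dom` from `PairLandauGaugeB8Avg`, per-pair Π-REG (uniform `Ĉ`), per-pair
`LandauCorrectionSupB8` (uniform `K₀ K₁`), per-pair (P♮) on `slicB8` (uniform `CP`), and uniform numeric lines. [folklore] -/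
theorem ne3EnergyRateWCov_sfClass_B8 [Nonempty n] (hd : 3 ≤ d) {L N : ℕ} [NeZero L] [NeZero N] (hL : 2 ≤ L) (hN : 1 ≤ N)
    {ε b g : ℝ} (hb : 0 ≤ b) (hbε : b < ε) (hε1 : ε ≤ 1) (hg : 0 < g)
    (hbs : 512 * (d + 1) * (d + 4) * (L : ℝ) ^ 2 * b ≤ 1) (hbε' : b + 226 * (8 * (d + 1) * (d + 4)) ^ 2 * b ^ 2 ≤ ε)
    (h1 : 16 * (14464 * ((d : ℝ) + 1) ^ 2 * ((d : ℝ) + 4) ^ 2) * ε ≤ 3) (h2 : 2 * twoLevelSmall d L * ε ≤ (L : ℝ) ^ 2)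
    (hθε : cruxC d L * ε < 1) (hθlε : thetaLoc d L * ε < 1)
    (hPsε : 8 * d * (((d : ℝ) - 1) * ε) ^ 2
      + 2 * (Fintype.card n * ((4 * (d : ℝ) ^ 2 + 16 * d * (17 * (((d : ℝ) + 1) * ((d : ℝ) + 4)))) * ε) ^ 2) ≤ 1 / 2)
    -- the [B7]-Prop-4 regime
    {α₀ s₁ s₂ : ℝ} (hα : 0 < α₀) (hα3 : C0 d * α₀ ≤ 1 / 3) (hα4 : 4 * α₀ ≤ c2' d L) (hεα : ε < α₀) (hs₁ : 0 ≤ s₁)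
    (hsmall : Real.exp (4 * (800 * ((d : ℝ) + 1) ^ 2 * ((d : ℝ) + 4)) * α₀) * (1 + 8 * (131072 * ((d : ℝ) + 1) ^ 2) * s₁) ≤ 2)
    (hc₃ : 2 * s₁ ≤ c3 d L)
    -- the uniform constants and letters, and the uniform size lines
    {Chat K₀ K₁ AN Ac ah Λ CP : ℝ} (hChat : 0 ≤ Chat) (hK₀ : 0 ≤ K₀) (hK₁ : 0 ≤ K₁) (hCP : 0 ≤ CP)
    (hAN : (liftC d / (1 - cruxC d L * ε) + K₁) * ((8 * (131072 * ((d : ℝ) + 1) ^ 2) * Real.exp (4 * (800 * ((d : ℝ) + 1) ^ 2 * ((d : ℝ) + 4)) * α₀)) * s₁ ^ 2) ≤ AN)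
    (hAc : (2 * (liftC d * (17 + 16 * (d : ℝ))) / (1 - cruxC d L * ε) + 2 * ε * K₀) * ((8 * (131072 * ((d : ℝ) + 1) ^ 2) * Real.exp (4 * (800 * ((d : ℝ) + 1) ^ 2 * ((d : ℝ) + 4)) * α₀)) * s₁ ^ 2) ≤ Ac)
    (hah : 3 * ε + 2 * Ac + 8192 * ((s₁ + AN) * AN) + 48 * s₁ ^ 2 + 1300 * ((s₁ + AN) + (1 + 2048 * (s₁ + AN)) * AN) ^ 2 ≤ ah)
    (hlines₁ : 50 * s₁ ≤ 1) (hlineJ : s₁ + 43 * AN ≤ 1) (hlineN : 1350 * AN ≤ 1) (hlineα : 20 * (s₁ + AN) ≤ 1)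
    (hlineαN : 50 * ((1 + 1024 * (s₁ + AN)) * AN) ≤ 1)
    (hρ : 2 * ((2 * (liftC d / (1 - thetaLoc d L * ε)) ^ 2 + 8 * Fintype.card n * ((d : ℝ) * liftC d ^ 2 * (2 * (d : ℝ) + 8) ^ 2 / (1 - thetaLoc d L * ε) ^ 2)) + (2 * (4 * d * (liftC d * (17 + 16 * (d : ℝ))) ^ 2 / (1 - thetaLoc d L * ε) ^ 2) + 128 * Fintype.card (T4AveragingDeficitWall.Plane d) * Fintype.card n * ((d : ℝ) * liftC d ^ 2 * (2 * (d : ℝ) + 8) ^ 2 / (1 - thetaLoc d L * ε) ^ 2))) * (8 * (131072 * ((d : ℝ) + 1) ^ 2) * Real.exp (4 * (800 * ((d : ℝ) + 1) ^ 2 * ((d : ℝ) + 4)) * α₀)) ^ 2 * Chat ^ 2 * s₁ ^ 2 ≤ 1 / 2)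
    (hlineΛ : (1 + 24 * Real.sqrt d * (Real.exp (10 * ((s₁ + AN) + (1 + 2048 * (s₁ + AN)) * AN)) - 1)) ^ 2 + 48 * d * ah ≤ Λ)
    (hlineCP : 112 * (d : ℝ) * ah * CP ≤ 1 / (2 * (Fintype.card n : ℝ)))
    (hreg₁ : CP * (Real.sqrt Λ - 1) ^ 2 ≤ 1 / 4)
    (hbudget : 2 * Λ * (2 * (1 + 4 * Real.sqrt (16 * d + 1)) * ((1 + 2048 * Real.sqrt (16 * d + 1)) * (2 * Real.sqrt ((2 * (liftC d / (1 - thetaLoc d L * ε)) ^ 2 + 8 * Fintype.card n * ((d : ℝ) * liftC d ^ 2 * (2 * (d : ℝ) + 8) ^ 2 / (1 - thetaLoc d L * ε) ^ 2)) + (2 * (4 * d * (liftC d * (17 + 16 * (d : ℝ))) ^ 2 / (1 - thetaLoc d L * ε) ^ 2) + 128 * Fintype.card (T4AveragingDeficitWall.Plane d) * Fintype.card n * ((d : ℝ) * liftC d ^ 2 * (2 * (d : ℝ) + 8) ^ 2 / (1 - thetaLoc d L * ε) ^ 2))) * (8 * (131072 * ((d : ℝ) + 1) ^ 2) * Real.exp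 (4 * (800 * ((d : ℝ) + 1) ^ 2 * ((d : ℝ) + 4)) * α₀)) * Chat * s₁))) + Λ * (2 * (1 + 4 * Real.sqrt (16 * d + 1)) * ((1 + 2048 * Real.sqrt (16 * d + 1)) * (2 * Real.sqrt ((2 * (liftC d / (1 - thetaLoc d L * ε)) ^ 2 + 8 * Fintype.card n * ((d : ℝ) * liftC d ^ 2 * (2 * (d : ℝ) + 8) ^ 2 / (1 - thetaLoc d L * ε) ^ 2)) + (2 * (4 * d * (liftC d * (17 + 16 * (d : ℝ))) ^ 2 / (1 - thetaLoc d L * ε) ^ 2) + 128 * Fintype.card (T4AveragingDeficitWall.Plane d) * Fintype.card n * ((d : ℝ) * liftC d ^ 2 * (2 * (d : ℝ) + 8) ^ 2 / (1 - thetaLoc d L * ε) ^ 2))) * (8 * (131072 * ((d : ℝ) + 1) ^ 2) * Real.exp (4 * (800 * ((d : ℝ) + 1) ^ 2 * ((d : ℝ) + 4)) * α₀)) * Chat * s₁))) ^ 2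
        + (2 * (4 * (2 * d * (liftC d * (17 + 16 * (d : ℝ))) / (1 - thetaLoc d L * ε) + 8 * Fintype.card (T4AveragingDeficitWall.Plane d) * Real.sqrt (Fintype.card n * ((d : ℝ) * liftC d ^ 2 * (2 * (d : ℝ) + 8) ^ 2 / (1 - thetaLoc d L * ε) ^ 2) * (N : ℝ) ^ d)) * (8 * (131072 * ((d : ℝ) + 1) ^ 2) * Real.exp (4 * (800 * ((d : ℝ) + 1) ^ 2 * ((d : ℝ) + 4)) * α₀)) * Chat ^ 2 * ah + 8192 * d * (4 * (liftC d / (1 - thetaLoc d L * ε) + 2 * Real.sqrt ((d : ℝ) * Fintype.card n * ((d : ℝ) * liftC d ^ 2 * (2 * (d : ℝ) + 8) ^ 2 / (1 - thetaLoc d L * ε) ^ 2) * (N : ℝ) ^ d)) * (8 * (131072 * ((d : ℝ) + 1) ^ 2) * Real.exp (4 * (800 * ((d : ℝ) + 1) ^ 2 * ((d : ℝ) + 4)) * α₀)) * Chat ^ 2 * ah)) + 912 * d * (1806 * (4 * (liftC d / (1 - thetaLoc d L * ε) + 2 * Real.sqrt ((d : ℝ) * Fintype.card n * ((d : ℝ)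 * liftC d ^ 2 * (2 * (d : ℝ) + 8) ^ 2 / (1 - thetaLoc d L * ε) ^ 2) * (N : ℝ) ^ d)) * (8 * (131072 * ((d : ℝ) + 1) ^ 2) * Real.exp (4 * (800 * ((d : ℝ) + 1) ^ 2 * ((d : ℝ) + 4)) * α₀)) * Chat ^ 2 * ah))) ≤ cLambda n CP Λ / 2)
    -- [B8] Thm 2 + (1.37) at the pair, over the class
    {dom : _root_.Set (Site d → Fin d → (Matrix n n ℂ)ˣ)} (hB8 : PairLandauGaugeB8Avg d (sfClass d L N ε) L N b g s₁ s₂ 1 dom)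
    -- per pair: the Π-REG majorant (uniform constant `Ĉ`)
    (hF6 : ∀ j : ℕ, ∀ V ∈ dom, ∀ UA UB : Site d → Fin d → (Matrix n n ℂ)ˣ,
      IsMinimiser d (sfClass d L N ε) L N (j + 1) V UA → IsMinimiser d (sfClass d L N ε) L N (j + 2) V UB → Regular d L N b g (j + 2) UB →
      ∀ (u : Site d → (Matrix n n ℂ)ˣ) (Z : Site d → Fin d → Matrix n n ℂ), LandauRepB8Avg L N (j + 1) (cavg L UB) UA u Z s₁ s₂ 1 →
        ∃ m : Site d → Fin d → ℝ, LocalSupMajorant L N (j + 1) Z m Chat ∧ ∀ (z : Site d) (κ : Fin d), m z κ ≤ s₁ * ((L : ℝ)⁻¹) ^ (j + 1))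
    -- per pair: the F5 shape (uniform constants `K₀ K₁`; for all proof arguments)
    (hF5 : ∀ j : ℕ, ∀ V ∈ dom, ∀ UB : Site d → Fin d → (Matrix n n ℂ)ˣ,
      IsMinimiser d (sfClass d L N ε) L N (j + 2) V UB → Regular d L N b g (j + 2) UB →
      ∀ (hWu : IsUnitaryCfg (cavg L UB)) (hx : 0 ≤ ε / ((L : ℝ) ^ (j + 1)) ^ 2) (hs : LevelSmall d L j (ε / ((L : ℝ) ^ (j + 1)) ^ 2))
        (hWx : SmallField (cavg L UB) (ε / ((L : ℝ) ^ (j + 1)) ^ 2))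
        (hθ : cruxC d L * (((L : ℝ) ^ (j + 1)) ^ 2 * (ε / ((L : ℝ) ^ (j + 1)) ^ 2)) < 1), LandauCorrectionSupB8 hL j hWu hx hs hWx N hθ K₀ K₁)
    -- per pair: (P♮) on B8's slice (uniform constant `CP`)
    (hP : ∀ j : ℕ, ∀ V ∈ dom, ∀ UB : Site d → Fin d → (Matrix n n ℂ)ˣ,
      IsMinimiser d (sfClass d L N ε) L N (j + 2) V UB → Regular d L N b g (j + 2) UB →
      SlicePoincare L (j + 1) (cavg L UB) (slicB8 L N (j + 1) (cavg L UB)) CP (periodBox (N * L ^ (j + 1)))) :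
    NE3EnergyRateWCov d (sfClass d L N ε) L N b g
      ((1 + (((1 + 2048 * Real.sqrt (16 * d + 1)) * (2 * Real.sqrt ((2 * (liftC d / (1 - thetaLoc d L * ε)) ^ 2 + 8 * Fintype.card n * ((d : ℝ) * liftC d ^ 2 * (2 * (d : ℝ) + 8) ^ 2 / (1 - thetaLoc d L * ε) ^ 2)) + (2 * (4 * d * (liftC d * (17 + 16 * (d : ℝ))) ^ 2 / (1 - thetaLoc d L * ε) ^ 2) + 128 * Fintype.card (T4AveragingDeficitWall.Plane d) * Fintype.card n * ((d : ℝ) * liftC d ^ 2 * (2 * (d : ℝ) + 8) ^ 2 / (1 - thetaLoc d L * ε) ^ 2))) * (8 * (131072 * ((d : ℝ) + 1) ^ 2) * Real.exp (4 * (800 * ((d : ℝ) + 1) ^ 2 * ((d : ℝ) + 4)) * α₀)) * Chat * s₁)) + 23 * Real.sqrt 2 * Real.sqrt (16 * d + 1) * (1 + ((1 + 2048 * Real.sqrt (16 * d + 1)) * (2 * Real.sqrt ((2 * (liftC d / (1 - thetaLoc d L * ε)) ^ 2 + 8 * Fintype.card n * ((d : ℝ) * liftC d ^ 2 * (2 *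 (d : ℝ) + 8) ^ 2 / (1 - thetaLoc d L * ε) ^ 2)) + (2 * (4 * d * (liftC d * (17 + 16 * (d : ℝ))) ^ 2 / (1 - thetaLoc d L * ε) ^ 2) + 128 * Fintype.card (T4AveragingDeficitWall.Plane d) * Fintype.card n * ((d : ℝ) * liftC d ^ 2 * (2 * (d : ℝ) + 8) ^ 2 / (1 - thetaLoc d L * ε) ^ 2))) * (8 * (131072 * ((d : ℝ) + 1) ^ 2) * Real.exp (4 * (800 * ((d : ℝ) + 1) ^ 2 * ((d : ℝ) + 4)) * α₀)) * Chat * s₁))))) * (4 / cLambda n CP Λ)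
        * ((1 + Real.sqrt (192 * ((d : ℝ) * L) * (d + Fintype.card (T4AveragingDeficitWall.Plane d))))
          * (Real.sqrt ((L : ℝ) ^ (d - 2))
            + (Real.sqrt ((L : ℝ) ^ (d - 2)) * Real.sqrt (8 * Fintype.card (T4AveragingDeficitWall.Plane d))
                * (128 * (d * (L : ℝ) ^ 2))
              + 2 * (2048 * ((d : ℝ) + 4) ^ 2 * (L : ℝ) ^ 2 * Real.sqrt (d * (L : ℝ) ^ d))) * b
            + b ^ 2 * (2 * (L : ℝ) ^ (d - 1) + 2 * (8 * d * (L : ℝ) ^ d)) * Real.sqrt (d / (g * (L : ℝ) ^ (d + 2))))))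
      s₁ s₂ dom := by
  have hql : 0 < 1 - thetaLoc d L * ε := by linarith only [hθlε]
  have hlC := liftC_nonneg d
  have hν : 0 ≤ ((1 + 2048 * Real.sqrt (16 * d + 1)) * (2 * Real.sqrt ((2 * (liftC d / (1 - thetaLoc d L * ε)) ^ 2 + 8 * Fintype.card n * ((d : ℝ) * liftC d ^ 2 * (2 * (d : ℝ) + 8) ^ 2 / (1 - thetaLoc d L * ε) ^ 2)) + (2 * (4 * d * (liftC d * (17 + 16 * (d : ℝ))) ^ 2 / (1 - thetaLoc d L * ε) ^ 2) + 128 * Fintype.card (T4AveragingDeficitWall.Plane d) * Fintype.card n * ((d : ℝ) * liftC d ^ 2 * (2 * (d : ℝ) + 8) ^ 2 / (1 - thetaLoc d L * ε) ^ 2))) * (8 * (131072 * ((d : ℝ) + 1) ^ 2) * Real.exp (4 * (800 * ((d : ℝ) + 1) ^ 2 * ((d : ℝ) + 4)) * α₀)) * Chat * s₁)) := by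
    have h1 : 0 ≤ 1 + 2048 * Real.sqrt (16 * (d : ℝ) + 1) := by positivity
    have h2 : 0 ≤ 2 * Real.sqrt ((2 * (liftC d / (1 - thetaLoc d L * ε)) ^ 2 + 8 * Fintype.card n * ((d : ℝ) * liftC d ^ 2 * (2 * (d : ℝ) + 8) ^ 2 / (1 - thetaLoc d L * ε) ^ 2)) + (2 * (4 * d * (liftC d * (17 + 16 * (d : ℝ))) ^ 2 / (1 - thetaLoc d L * ε) ^ 2) + 128 * Fintype.card (T4AveragingDeficitWall.Plane d) * Fintype.card n * ((d : ℝ) * liftC d ^ 2 * (2 * (d : ℝ) + 8) ^ 2 / (1 - thetaLoc d L * ε) ^ 2))) := by positivity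
    have h3 : 0 ≤ (8 * (131072 * ((d : ℝ) + 1) ^ 2) * Real.exp (4 * (800 * ((d : ℝ) + 1) ^ 2 * ((d : ℝ) + 4)) * α₀)) := by positivity
    exact mul_nonneg h1 (mul_nonneg (mul_nonneg (mul_nonneg h2 h3) hChat) hs₁)
  refine ne3EnergyRateWCov_sfClass_of_pairLandauGaugeB8Avg_R25 hd hL hN hb hbε hε1 hg hbs hbε' h1 h2 hCP hreg₁ hν hbudget hB8 ?_
  intro j V hV UA UB hA hB hreg u Z hZ
  have hε : 0 ≤ ε := by linarith only [hb, hbε]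
  obtain ⟨m, hmaj, hmb⟩ := hF6 j V hV UA UB hA hB hreg u Z hZ
  obtain ⟨X, Nn, α, αN, a, hdec, hΓ0, hα40, hαN100, hJ1, hJ2⟩ :=
    decomposedRepT_sfClass_of_landauRepB8Avg hd hL hN hb hε hε1 hbs hbε' h1 h2 hθε hθlε hPsε hα hα3 hα4 hεα hs₁ hsmall hc₃
      hK₀ hK₁ hCP hAN hAc hah hlines₁ hlineJ hlineN hlineα hlineαN hρ hlineΛ hlineCP j hA hB hreg hZ hmaj hmb (hF5 j V hV UB hB hreg)
  exact ⟨X, Nn, α, αN, a, hdec, hΓ0, hα40, hαN100, hJ1, hJ2, hP j V hV UB hB hreg⟩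

end

end Summit.QuantumFields.BalabanUV.T4Continuum.NE3.PairLandauB8EndSfClassB8
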